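import Summits.CriticalPhenomena.PercolationContinuityZ3.Theorems.PercNearOneGluingNoHeavyLowerTailSahiGridPatternLiteralTwoGood
import Summits.CriticalPhenomena.PercolationContinuityZ3.Theorems.PercNearOneGluingNoHeavyLowerTailSahiGridPatternDiagCert
import Summits.CriticalPhenomena.PercolationContinuityZ3.Theorems.PercNearOneGluingNoHeavyLowerTailSahiGridPatternKleitman
import Summits.CriticalPhenomena.PercolationContinuityZ3.Theorems.PercNearOneGluingNoHeavyLowerTailSahiGridPatternTwoSetsTop
import Summits.CriticalPhenomena.PercolationContinuityZ3.Theorems.PercNearOneGluingNoHeavyLowerTailSahiGridPatternHarris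

/-!
# `NoHeavyLowerTail` (crux stmt-CriticalPhenomena-4575), Sahi programme P1: **AN EXPLICIT DIAGONAL CERTIFICATE FOR `{x₀ ≥ 1} ∨ V`, EVERY UP-SET `V`**, and Latin-role symmetrisation

Support file (Sahi cell, seat `prim-sahi-p1`, generation 28; `--supports stmt-CriticalPhenomena-4575`).  Pure proofs, no definitions, no `sorry`, standard axioms.
For ANY up-set `V ⊆ [3]^k` let `A = {x₀ ≥ 1} ∪ [3]×V ⊆ [3]^{1+k}` (`glue ξ z ∈ A ↔ 1 ≤ ξ 0 ∨ z ∈ V`) and `h_V = 2^k·1_V − ν_V` (Harris density).  THEOREM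
(`diagCert_literalOneOr_T/N`, every `k`): `d'(x) = 2^{k+1}1_V(tail x)` (`x₀ = 0`), `= 2^{k+1} + h_V(tail x)` (`x₀ ≥ 1`) is a DIAGONAL CERTIFICATE of `A` ((T'), (N') of
`…SahiGridPatternDiagCert`), with no hypothesis on `V` beyond monotonicity; hence `A × [3]^n` is good in every dimension (`sStarD_cylSet_literalOneOr_nonneg`; the certificate form
of the atom-free literal-union step).  (T') is the identity `λ_A(W') − d'(W') = 2^k[Σ(1−1_V)(1_{W₁}−1_{W₀}) + Σ(1−1_V)(1_{W₂}−1_{W₀})]`; (N') a 13-column identity (four weighted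
fibre-Kleitman sums, four coefficientwise Harris sums for `(B_t, C₀∩V)`, `(C_t, B₀∩V)`, four pointwise products) found by the seat's symbolic LP `nest2.py` and valid after
symmetrisation over the SIX Latin roles — whence the reusable lemma `pairSum_eq_of_sym6_eq` (kernels `F(q,r)` of a totally-distinct pair, third point `q̄r` implicit; re-indexing
by the involution `r ↦ q̄r`).  Seat memo FROM-prim-sahi-p1-gen28 §3bis.  Nothing here asserts `PatternPos d` for `d ≥ 4`. [this work]
-/

namespace Summit.CriticalPhenomena.PercolationContinuityZ3.Theorems.SahiGridPattern

open Finset SahiGrid3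
open scoped BigOperators

variable {k : ℕ}

/-! ### Latin-role symmetrisation of totally-distinct pair sums -/

/-- Third points: `q̄(q̄r) = r` in the four mixed forms needed below. [this work] -/
theorem thirdPt_cancel (q r : Pd k) :
    thirdPt q (thirdPt q r) = r ∧ thirdPt (thirdPt q r) q = r ∧ thirdPt r (thirdPt q r) = q ∧ thirdPt (thirdPt q r) r = q := by
  refine ⟨thirdPt_thirdPt q r, ?_, ?_, ?_⟩
  · rw [thirdPt_comm (thirdPt q r) q, thirdPt_thirdPt]
  · rw [thirdPt_comm q r, thirdPt_thirdPt]
  · rw [thirdPt_comm (thirdPt q r) r, thirdPt_comm q r, thirdPt_thirdPt]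

/-- Swap of the two summation points (the third point `q̄r` is symmetric). [this work] -/
theorem pairSum_latin_swap (F : Pd k → Pd k → ℤ) :
    (∑ q : Pd k, ∑ r : Pd k, (if TotDist q r = true then (1:ℤ) else 0) * F q r)
      = ∑ q : Pd k, ∑ r : Pd k, (if TotDist q r = true then (1:ℤ) else 0) * F r q := by
  rw [Finset.sum_comm]
  refine Finset.sum_congr rfl fun q _ => Finset.sum_congr rfl fun r _ => ?_
  rw [totDist_symm r q]

/-- Exchange of the second point with the third point (re-indexing by the involution `r ↦ q̄r`). [this work] -/
theorem pairSum_latin_rot (F : Pd k → Pd k → ℤ) :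
    (∑ q : Pd k, ∑ r : Pd k, (if TotDist q r = true then (1:ℤ) else 0) * F q r)
      = ∑ q : Pd k, ∑ r : Pd k, (if TotDist q r = true then (1:ℤ) else 0) * F q (thirdPt q r) := by
  refine Finset.sum_congr rfl fun q _ => ?_
  have hinv : Function.Involutive (thirdPt q) := fun r => thirdPt_thirdPt q r
  refine Fintype.sum_equiv (hinv.toPerm _) _ _ (fun r => ?_)
  show (if TotDist q r = true then (1:ℤ) else 0) * F q r
      = (if TotDist q (thirdPt q r) = true then (1:ℤ) else 0) * F q (thirdPt q (thirdPt q r))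
  rw [totDist_thirdPt_right, thirdPt_thirdPt]

/-- **Latin-role symmetrisation**: a kernel `F(q,r)` of a totally-distinct pair is read as a function of the Latin triple `(q, r, q̄r)`; if `F` and `G`
have the same sum over the six role assignments of every triple, their pair sums agree. [this work] -/
theorem pairSum_eq_of_sym6_eq (F G : Pd k → Pd k → ℤ)
    (h : ∀ q r : Pd k, F q r + F r q + F q (thirdPt q r) + F (thirdPt q r) q + F r (thirdPt q r) + F (thirdPt q r) r
        = G q r + G r q + G q (thirdPt q r) + G (thirdPt q r) q + G r (thirdPt q r) + G (thirdPt q r) r) :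
    (∑ q : Pd k, ∑ r : Pd k, (if TotDist q r = true then (1:ℤ) else 0) * F q r)
      = ∑ q : Pd k, ∑ r : Pd k, (if TotDist q r = true then (1:ℤ) else 0) * G q r := by
  have six : ∀ K : Pd k → Pd k → ℤ,
      (∑ q : Pd k, ∑ r : Pd k, (if TotDist q r = true then (1:ℤ) else 0) *
        (K q r + K r q + K q (thirdPt q r) + K (thirdPt q r) q + K r (thirdPt q r) + K (thirdPt q r) r))
      = 6 * ∑ q : Pd k, ∑ r : Pd k, (if TotDist q r = true then (1:ℤ) else 0) * K q r := by
    intro K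
    have e1 := pairSum_latin_swap K
    have e2 := pairSum_latin_rot K
    have e3 := pairSum_latin_rot (fun a b => K b a)
    have e4 := pairSum_latin_swap (fun a b => K a (thirdPt a b))
    have e5 := pairSum_latin_swap (fun a b => K (thirdPt a b) a)
    have e4' : (∑ q : Pd k, ∑ r : Pd k, (if TotDist q r = true then (1:ℤ) else 0) * K q (thirdPt q r))
        = ∑ q : Pd k, ∑ r : Pd k, (if TotDist q r = true then (1:ℤ) else 0) * K r (thirdPt q r) := by
      rw [e4]; refine Finset.sum_congr rfl fun q _ => Finset.sum_congr rfl fun r _ => ?_; rw [thirdPt_comm r q]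
    have e5' : (∑ q : Pd k, ∑ r : Pd k, (if TotDist q r = true then (1:ℤ) else 0) * K (thirdPt q r) q)
        = ∑ q : Pd k, ∑ r : Pd k, (if TotDist q r = true then (1:ℤ) else 0) * K (thirdPt q r) r := by
      rw [e5]; refine Finset.sum_congr rfl fun q _ => Finset.sum_congr rfl fun r _ => ?_; rw [thirdPt_comm r q]
    have s : ∀ q r : Pd k, (if TotDist q r = true then (1:ℤ) else 0) *
        (K q r + K r q + K q (thirdPt q r) + K (thirdPt q r) q + K r (thirdPt q r) + K (thirdPt q r) r)
        = (if TotDist q r = true then (1:ℤ) else 0) * K q r + (if TotDist q r = true then (1:ℤ) else 0) * K r q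
          + (if TotDist q r = true then (1:ℤ) else 0) * K q (thirdPt q r) + (if TotDist q r = true then (1:ℤ) else 0) * K (thirdPt q r) q
          + (if TotDist q r = true then (1:ℤ) else 0) * K r (thirdPt q r) + (if TotDist q r = true then (1:ℤ) else 0) * K (thirdPt q r) r :=
      fun q r => by ring
    simp only [s, Finset.sum_add_distrib]
    rw [← e5', ← e4', ← e3, ← e2, ← e1]
    ring
  have hF := six F
  have hG := six G
  have hFG : (∑ q : Pd k, ∑ r : Pd k, (if TotDist q r = true then (1:ℤ) else 0) *
        (F q r + F r q + F q (thirdPt q r) + F (thirdPt q r) q + F r (thirdPt q r) + F (thirdPt q r) r))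
      = ∑ q : Pd k, ∑ r : Pd k, (if TotDist q r = true then (1:ℤ) else 0) *
        (G q r + G r q + G q (thirdPt q r) + G (thirdPt q r) q + G r (thirdPt q r) + G (thirdPt q r) r) :=
    Finset.sum_congr rfl fun q _ => Finset.sum_congr rfl fun r _ => by rw [h]
  rw [hF, hG] at hFG
  omega
/-! ### Small tools -/

/-- A sum over a finset of `[3]^{1+k}` split along the first axis into the three levels. -/
private theorem sum_mem_eq_levels' (W : Finset (Pd (1 + k))) (f : Pd (1 + k) → ℤ) :
    (∑ x ∈ W, f x) = (∑ q : Pd k, ind W (glue (fun _ => 0) q) * f (glue (fun _ => 0) q))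
      + (∑ q : Pd k, ind W (glue (fun _ => 1) q) * f (glue (fun _ => 1) q))
      + (∑ q : Pd k, ind W (glue (fun _ => 2) q) * f (glue (fun _ => 2) q)) := by
  rw [sum_mem_eq_sum_ind_mul, sum_glue, sum_pd1]

/-- `ν` of a set of `[3]^{1+k}` at a glued point, by levels. -/
private theorem nuCount_glue_eq' (A : Finset (Pd (1 + k))) (ξ : Pd 1) (q : Pd k) :
    (nuCount A (glue ξ q) : ℤ) = ∑ η : Pd 1, (if TotDist η ξ = true then (1:ℤ) else 0) *
      ∑ r : Pd k, ind A (glue η r) * (if TotDist r q = true then (1:ℤ) else 0) := by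
  rw [nuCount_eq_sum_ind, sum_glue]
  refine Finset.sum_congr rfl fun η _ => ?_
  rw [Finset.mul_sum]
  refine Finset.sum_congr rfl fun r _ => ?_
  by_cases h : TotDist (glue η r) (glue ξ q) = true
  · obtain ⟨h1, h2⟩ := (totDist_glue η ξ r q).1 h
    rw [if_pos h, if_pos h1, if_pos h2]; ring
  · rw [if_neg h]
    have : ¬ (TotDist η ξ = true ∧ TotDist r q = true) := fun hh => h ((totDist_glue η ξ r q).2 hh)
    by_cases h1 : TotDist η ξ = true
    · have h2 : ¬ TotDist r q = true := fun h2 => this ⟨h1, h2⟩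
      rw [if_pos h1, if_neg h2]; ring
    · rw [if_neg h1]; ring

/-- Section increments of an up-set of `[3]^{1+k}` are nonnegative. -/
private theorem ind_glue_sub_nonneg' {B : Finset (Pd (1 + k))} (hB : IsUpperSet (B : Set (Pd (1 + k)))) {s t : Fin 3} (hst : s ≤ t)
    (q : Pd k) : 0 ≤ ind B (glue (fun _ : Fin 1 => t) q) - ind B (glue (fun _ : Fin 1 => s) q) := by
  have hle : glue (fun _ : Fin 1 => s) q ≤ glue (fun _ : Fin 1 => t) q := by
    intro a
    refine Fin.addCases (fun i => ?_) (fun j => ?_) a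
    · simp only [glue, Fin.append_left]; exact hst
    · simp only [glue, Fin.append_right]; exact le_rfl
  unfold ind
  by_cases h : glue (fun _ : Fin 1 => s) q ∈ B
  · rw [if_pos h, if_pos (Finset.mem_coe.1 (hB hle h))]; norm_num
  · rw [if_neg h]; split_ifs <;> norm_num

/-- Weighted fibre Kleitman: `0 ≤ Σ_q f(q) Σ_r [q δ̸ r]·1_X(r)(1_Q(r) − 1_Q(q̄r))` for `f ≥ 0`. [this work] -/
theorem weighted_kleitman_nonneg₂ {X Q : Finset (Pd k)} (hX : IsUpperSet (X : Set (Pd k))) (hQ : IsUpperSet (Q : Set (Pd k)))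
    (f : Pd k → ℤ) (hf : ∀ q, 0 ≤ f q) :
    0 ≤ ∑ q : Pd k, ∑ r : Pd k, (if TotDist q r = true then (1:ℤ) else 0) * (f q * (ind X r * (ind Q r - ind Q (thirdPt q r)))) := by
  refine Finset.sum_nonneg fun q _ => ?_
  have h := sum_klCoef_ind_nonneg hQ hX q
  have e : (∑ r : Pd k, (if TotDist q r = true then (1:ℤ) else 0) * (f q * (ind X r * (ind Q r - ind Q (thirdPt q r)))))
      = f q * ∑ r : Pd k, klCoef Q q r * ind X r := by
    rw [Finset.mul_sum]; refine Finset.sum_congr rfl fun r _ => ?_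
    unfold klCoef; rw [totDist_symm r q, thirdPt_comm r q]; split_ifs <;> ring
  rw [e]; exact mul_nonneg (hf q) h

/-- Coefficientwise Harris as a pair sum: `0 ≤ Σ_q Σ_r [q δ̸ r]·1_P(q)(1_Q(q) − 1_Q(r))` for up-sets `P, Q`. [this work] -/
theorem harris_pair_nonneg {P Q : Finset (Pd k)} (hP : IsUpperSet (P : Set (Pd k))) (hQ : IsUpperSet (Q : Set (Pd k))) :
    0 ≤ ∑ q : Pd k, ∑ r : Pd k, (if TotDist q r = true then (1:ℤ) else 0) * (ind P q * (ind Q q - ind Q r)) := by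
  have h := sum_ind_totDist_le k P Q hP hQ
  have e1 : (2:ℤ) ^ k * ∑ p : Pd k, ind P p * ind Q p = ∑ q : Pd k, ∑ r : Pd k, (if TotDist q r = true then (1:ℤ) else 0) * (ind P q * ind Q q) := by
    rw [Finset.mul_sum]
    refine Finset.sum_congr rfl fun q _ => ?_
    rw [← Finset.sum_mul, sum_ite_totDist_eq_two_pow]
  have e2 : (∑ q : Pd k, ∑ r : Pd k, (if TotDist q r = true then (1:ℤ) else 0) * (ind P q * (ind Q q - ind Q r)))
      = (∑ q : Pd k, ∑ r : Pd k, (if TotDist q r = true then (1:ℤ) else 0) * (ind P q * ind Q q))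
        - ∑ q : Pd k, ∑ r : Pd k, ind P q * ind Q r * (if TotDist q r = true then (1:ℤ) else 0) := by
    rw [← Finset.sum_sub_distrib]
    refine Finset.sum_congr rfl fun q _ => ?_
    rw [← Finset.sum_sub_distrib]
    refine Finset.sum_congr rfl fun r _ => ?_
    ring
  rw [e2, ← e1]
  linarith

variable {V : Finset (Pd k)} {A : Finset (Pd (1 + k))}

/-- Indicator of `A = {x₀ ≥ 1} ∨ V` at a glued point. [this work] -/
theorem ind_glue_literalOneOr (hA : ∀ ξ z, glue ξ z ∈ A ↔ (1 ≤ ξ 0 ∨ z ∈ V)) (ξ : Pd 1) (z : Pd k) :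
    ind A (glue ξ z) = if 1 ≤ ξ 0 then 1 else ind V z := by
  unfold ind
  simp only [hA]
  by_cases h1 : 1 ≤ ξ 0 <;> by_cases h2 : z ∈ V <;> simp [h1, h2]

/-- `λ_A` at the three levels of `A = {x₀ ≥ 1} ∨ V`: `λ_A(0,q) = 2^{k+2}1_V(q) − 2^{k+1}`, `λ_A(1,q) = λ_A(2,q) = 3·2^k − ν_V(q)` (ν as a pair sum). [this work] -/
theorem lamU_literalOneOr_levels (hA : ∀ ξ z, glue ξ z ∈ A ↔ (1 ≤ ξ 0 ∨ z ∈ V)) (q : Pd k) :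
    lamU A (glue (fun _ => 0) q) = 2 * 2 ^ (1 + k) * ind V q - 2 * 2 ^ k
    ∧ lamU A (glue (fun _ => 1) q) = 3 * 2 ^ k - ∑ r : Pd k, ind V r * (if TotDist r q = true then (1:ℤ) else 0)
    ∧ lamU A (glue (fun _ => 2) q) = 3 * 2 ^ k - ∑ r : Pd k, ind V r * (if TotDist r q = true then (1:ℤ) else 0) := by
  obtain ⟨h00, h11, h22, h01, h02, h10, h12, h20, h21, -, -, -, -, -, -⟩ := pd1_facts
  have iv : ∀ z, ind A (glue (fun _ => 0) z) = ind V z := fun z => by rw [ind_glue_literalOneOr hA]; simp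
  have i1 : ∀ z, ind A (glue (fun _ => 1) z) = 1 := fun z => by rw [ind_glue_literalOneOr hA]; simp
  have i2 : ∀ z, ind A (glue (fun _ => 2) z) = 1 := fun z => by rw [ind_glue_literalOneOr hA]; simp [show (1:Fin 3) ≤ 2 by decide]
  have hpow : (∑ r : Pd k, (1:ℤ) * (if TotDist r q = true then (1:ℤ) else 0)) = 2 ^ k := by
    have e : (∑ r : Pd k, (1:ℤ) * (if TotDist r q = true then (1:ℤ) else 0)) = ∑ r : Pd k, (if TotDist q r = true then (1:ℤ) else 0) :=
      Finset.sum_congr rfl fun r _ => by rw [totDist_symm r q]; ring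
    rw [e, sum_ite_totDist_eq_two_pow]
  have e : ∀ ξ : Pd 1, (nuCount A (glue ξ q) : ℤ) =
      (if TotDist (fun _ : Fin 1 => (0:Fin 3)) ξ = true then (1:ℤ) else 0) * (∑ r : Pd k, ind V r * (if TotDist r q = true then (1:ℤ) else 0))
      + ((if TotDist (fun _ : Fin 1 => (1:Fin 3)) ξ = true then (1:ℤ) else 0) + (if TotDist (fun _ : Fin 1 => (2:Fin 3)) ξ = true then (1:ℤ) else 0)) * 2 ^ k := by
    intro ξ
    rw [nuCount_glue_eq', sum_pd1]
    simp only [iv, i1, i2, hpow]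
    ring
  have p1 : (2:ℤ) ^ (1 + k) = 2 * 2 ^ k := by rw [pow_add, pow_one]
  unfold lamU
  refine ⟨?_, ?_, ?_⟩
  · rw [e, iv]; simp only [h00, h10, h20, Bool.false_eq_true, if_false, if_true, p1]; ring
  · rw [e, i1]; simp only [h01, h11, h21, Bool.false_eq_true, if_false, if_true, p1]; ring
  · rw [e, i2]; simp only [h02, h12, h22, Bool.false_eq_true, if_false, if_true, p1]; ring
/-! ### (T') -/

/-- **(T') for `{x₀ ≥ 1} ∨ V`** (every up-set `V`, no certificate needed): with `d' = (2^{k+1}1_V, 2^{k+1}+h_V, 2^{k+1}+h_V)`,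
`Σ_{x∈W'} d'(x) ≤ Σ_{x∈W'} λ_A(x)` for every up-set `W' ⊆ [3]^{1+k}`; the slack is `2^k[Σ(1−1_V)(1_{W₁}−1_{W₀}) + Σ(1−1_V)(1_{W₂}−1_{W₀})]`. [this work] -/
theorem diagCert_literalOneOr_T (hA : ∀ ξ z, glue ξ z ∈ A ↔ (1 ≤ ξ 0 ∨ z ∈ V)) (W' : Finset (Pd (1 + k))) (hW' : IsUpperSet (W' : Set (Pd (1 + k)))) :
    (∑ x ∈ W', (fun x => if freeOf x 0 = 0 then 2 * 2 ^ k * ind V (cellOf x)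
        else 2 * 2 ^ k + (2 ^ k * ind V (cellOf x) - (nuCount V (cellOf x) : ℤ))) x) ≤ ∑ x ∈ W', lamU A x := by
  have hl := lamU_literalOneOr_levels hA
  rw [sum_mem_eq_levels' W' _, sum_mem_eq_levels' W' (lamU A)]
  simp only [freeOf_glue, cellOf_glue, show ¬ ((1:Fin 3) = 0) by decide, show ¬ ((2:Fin 3) = 0) by decide, if_false, if_true]
  have hνeq : ∀ q : Pd k, (nuCount V q : ℤ) = ∑ r : Pd k, ind V r * (if TotDist r q = true then (1:ℤ) else 0) := fun q => nuCount_eq_sum_ind V q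
  have e0 : (∑ q : Pd k, ind W' (glue (fun _ => 0) q) * lamU A (glue (fun _ => 0) q))
      = ∑ q : Pd k, ind W' (glue (fun _ => 0) q) * (2 * 2 ^ (1 + k) * ind V q - 2 * 2 ^ k) :=
    Finset.sum_congr rfl fun q _ => by rw [(hl q).1]
  have e1 : (∑ q : Pd k, ind W' (glue (fun _ => 1) q) * lamU A (glue (fun _ => 1) q))
      = ∑ q : Pd k, ind W' (glue (fun _ => 1) q) * (3 * 2 ^ k - (nuCount V q : ℤ)) :=
    Finset.sum_congr rfl fun q _ => by rw [(hl q).2.1, hνeq q]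
  have e2 : (∑ q : Pd k, ind W' (glue (fun _ => 2) q) * lamU A (glue (fun _ => 2) q))
      = ∑ q : Pd k, ind W' (glue (fun _ => 2) q) * (3 * 2 ^ k - (nuCount V q : ℤ)) :=
    Finset.sum_congr rfl fun q _ => by rw [(hl q).2.2, hνeq q]
  rw [e0, e1, e2]
  have p1 : (2:ℤ) ^ (1 + k) = 2 * 2 ^ k := by rw [pow_add, pow_one]
  have hn01 := fun q => ind_glue_sub_nonneg' hW' (show (0:Fin 3) ≤ 1 by decide) q
  have hn02 := fun q => ind_glue_sub_nonneg' hW' (show (0:Fin 3) ≤ 2 by decide) q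
  have hV1 : ∀ q : Pd k, ind V q ≤ 1 := fun q => ind_le_one' V q
  have hpos : (0:ℤ) < 2 ^ k := by positivity
  -- slack = 2^k Σ (1 − 1_V)(W₁ − W₀) + 2^k Σ (1 − 1_V)(W₂ − W₀) ≥ 0
  have key : ∀ q : Pd k,
      ind W' (glue (fun _ => 0) q) * (2 * 2 ^ k * ind V q)
        + ind W' (glue (fun _ => 1) q) * (2 * 2 ^ k + (2 ^ k * ind V q - (nuCount V q : ℤ)))
        + ind W' (glue (fun _ => 2) q) * (2 * 2 ^ k + (2 ^ k * ind V q - (nuCount V q : ℤ)))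
      ≤ ind W' (glue (fun _ => 0) q) * (2 * 2 ^ (1 + k) * ind V q - 2 * 2 ^ k)
        + ind W' (glue (fun _ => 1) q) * (3 * 2 ^ k - (nuCount V q : ℤ))
        + ind W' (glue (fun _ => 2) q) * (3 * 2 ^ k - (nuCount V q : ℤ)) := by
    intro q
    rw [p1]
    have c : 0 ≤ 1 - ind V q := by have := hV1 q; linarith
    have t1 : 0 ≤ (2:ℤ) ^ k * ((1 - ind V q) * (ind W' (glue (fun _ => 1) q) - ind W' (glue (fun _ => 0) q))) :=
      mul_nonneg hpos.le (mul_nonneg c (hn01 q))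
    have t2 : 0 ≤ (2:ℤ) ^ k * ((1 - ind V q) * (ind W' (glue (fun _ => 2) q) - ind W' (glue (fun _ => 0) q))) :=
      mul_nonneg hpos.le (mul_nonneg c (hn02 q))
    nlinarith [t1, t2]
  calc _ = ∑ q : Pd k, (ind W' (glue (fun _ => 0) q) * (2 * 2 ^ k * ind V q)
        + ind W' (glue (fun _ => 1) q) * (2 * 2 ^ k + (2 ^ k * ind V q - (nuCount V q : ℤ)))
        + ind W' (glue (fun _ => 2) q) * (2 * 2 ^ k + (2 ^ k * ind V q - (nuCount V q : ℤ)))) := by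
          rw [← Finset.sum_add_distrib, ← Finset.sum_add_distrib]
    _ ≤ ∑ q : Pd k, (ind W' (glue (fun _ => 0) q) * (2 * 2 ^ (1 + k) * ind V q - 2 * 2 ^ k)
        + ind W' (glue (fun _ => 1) q) * (3 * 2 ^ k - (nuCount V q : ℤ))
        + ind W' (glue (fun _ => 2) q) * (3 * 2 ^ k - (nuCount V q : ℤ))) := Finset.sum_le_sum fun q _ => key q
    _ = _ := by rw [← Finset.sum_add_distrib, ← Finset.sum_add_distrib]

/-! ### (N') -/

/-- **(N') for `{x₀ ≥ 1} ∨ V`** (every up-set `V`): `Σ_{x∈B,y∈C} Θ_A(x,y) ≤ Σ_{x∈B∩C} d'(x)` for all up-sets `B, C ⊆ [3]^{1+k}`.  Proof: a 13-column identity (Kleitman,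
Harris, pointwise) valid after Latin-role symmetrisation. [this work] -/
theorem diagCert_literalOneOr_N (hV : IsUpperSet (V : Set (Pd k))) (hA : ∀ ξ z, glue ξ z ∈ A ↔ (1 ≤ ξ 0 ∨ z ∈ V))
    (B C : Finset (Pd (1 + k))) (hB : IsUpperSet (B : Set (Pd (1 + k)))) (hC : IsUpperSet (C : Set (Pd (1 + k)))) :
    (∑ x ∈ B, ∑ y ∈ C, thetaVal A x y) ≤ ∑ x ∈ B ∩ C, (fun x => if freeOf x 0 = 0 then 2 * 2 ^ k * ind V (cellOf x)
        else 2 * 2 ^ k + (2 ^ k * ind V (cellOf x) - (nuCount V (cellOf x) : ℤ))) x := by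
  have iv : ∀ z, ind A (glue (fun _ => 0) z) = ind V z := fun z => by rw [ind_glue_literalOneOr hA]; simp
  have i1 : ∀ z, ind A (glue (fun _ => 1) z) = 1 := fun z => by rw [ind_glue_literalOneOr hA]; simp
  have i2 : ∀ z, ind A (glue (fun _ => 2) z) = 1 := fun z => by rw [ind_glue_literalOneOr hA]; simp [show (1:Fin 3) ≤ 2 by decide]
  have hl := lamU_literalOneOr_levels hA
  have eS := sStarD_eq_sum_lamU_sub_sum_thetaVal A B C
  suffices key : (∑ x ∈ B ∩ C, lamU A x) - (∑ x ∈ B ∩ C, (fun x => if freeOf x 0 = 0 then 2 * 2 ^ k * ind V (cellOf x)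
        else 2 * 2 ^ k + (2 ^ k * ind V (cellOf x) - (nuCount V (cellOf x) : ℤ))) x) ≤ sStarD A B C by
    linarith
  -- Σ_{B∩C} (λ_A − d') = Σ_q Σ_r [td] (1 − 1_V(q)) (−2 B₀C₀ + B₁C₁ + B₂C₂)(q)
  have L : (∑ x ∈ B ∩ C, lamU A x) - (∑ x ∈ B ∩ C, (fun x => if freeOf x 0 = 0 then 2 * 2 ^ k * ind V (cellOf x)
        else 2 * 2 ^ k + (2 ^ k * ind V (cellOf x) - (nuCount V (cellOf x) : ℤ))) x)
      = ∑ q : Pd k, ∑ r : Pd k, (if TotDist q r = true then (1:ℤ) else 0) *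
          ((1 - ind V q) * (- 2 * (ind B (glue (fun _ => 0) q) * ind C (glue (fun _ => 0) q))
            + ind B (glue (fun _ => 1) q) * ind C (glue (fun _ => 1) q) + ind B (glue (fun _ => 2) q) * ind C (glue (fun _ => 2) q))) := by
    rw [sum_mem_eq_levels' (B ∩ C) (lamU A), sum_mem_eq_levels' (B ∩ C)]
    simp only [ind_inter_eq_mul, freeOf_glue, cellOf_glue, show ¬ ((1:Fin 3) = 0) by decide, show ¬ ((2:Fin 3) = 0) by decide,
      if_false, if_true]
    have p1 : (2:ℤ) ^ (1 + k) = 2 * 2 ^ k := by rw [pow_add, pow_one]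
    have c : ∀ q : Pd k, ∀ g : ℤ, (2:ℤ) ^ k * g = ∑ r : Pd k, (if TotDist q r = true then (1:ℤ) else 0) * g := by
      intro q g; rw [← Finset.sum_mul, sum_ite_totDist_eq_two_pow]
    rw [← Finset.sum_add_distrib, ← Finset.sum_add_distrib, ← Finset.sum_add_distrib, ← Finset.sum_add_distrib, ← Finset.sum_sub_distrib]
    refine Finset.sum_congr rfl fun q _ => ?_
    rw [(hl q).1, (hl q).2.1, (hl q).2.2, ← nuCount_eq_sum_ind V q, p1]
    have := c q ((1 - ind V q) * (- 2 * (ind B (glue (fun _ => 0) q) * ind C (glue (fun _ => 0) q))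
            + ind B (glue (fun _ => 1) q) * ind C (glue (fun _ => 1) q) + ind B (glue (fun _ => 2) q) * ind C (glue (fun _ => 2) q)))
    rw [← this]
    ring
  rw [L, sStarD_eq_pd1_sections A B C]
  simp only [iv, i1, i2]
  -- the thirteen nonnegative columns
  have hB01 := fun q => ind_glue_sub_nonneg' hB (show (0:Fin 3) ≤ 1 by decide) q
  have hB02 := fun q => ind_glue_sub_nonneg' hB (show (0:Fin 3) ≤ 2 by decide) q
  have hB12 := fun q => ind_glue_sub_nonneg' hB (show (1:Fin 3) ≤ 2 by decide) q
  have hC01 := fun q => ind_glue_sub_nonneg' hC (show (0:Fin 3) ≤ 1 by decide) q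
  have hC02 := fun q => ind_glue_sub_nonneg' hC (show (0:Fin 3) ≤ 2 by decide) q
  have hC12 := fun q => ind_glue_sub_nonneg' hC (show (1:Fin 3) ≤ 2 by decide) q
  have hcV : ∀ q : Pd k, 0 ≤ 1 - ind V q := fun q => by have := ind_le_one' V q; linarith
  have hVn : ∀ q : Pd k, 0 ≤ ind V q := fun q => ind_nonneg' V q
  have K1 := weighted_kleitman_nonneg₂ (isUpperSet_sect hB (fun _ => 1)) (isUpperSet_sect hC (fun _ => 2)) (fun _ => (1:ℤ)) (fun _ => by norm_num)
  have K2 := weighted_kleitman_nonneg₂ (isUpperSet_sect hB (fun _ => 2)) (isUpperSet_sect hC (fun _ => 1)) (fun _ => (1:ℤ)) (fun _ => by norm_num)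
  have K3 := weighted_kleitman_nonneg₂ (isUpperSet_sect hB (fun _ => 2)) (isUpperSet_sect hC (fun _ => 2)) _ hcV
  have K4 := weighted_kleitman_nonneg₂ (isUpperSet_sect hB (fun _ => 1)) (isUpperSet_sect hC (fun _ => 1)) _ hcV
  have hC0V : IsUpperSet ((sect C (fun _ : Fin 1 => (0:Fin 3)) ∩ V : Finset (Pd k)) : Set (Pd k)) := by
    rw [Finset.coe_inter]; exact (isUpperSet_sect hC _).inter hV
  have hB0V : IsUpperSet ((sect B (fun _ : Fin 1 => (0:Fin 3)) ∩ V : Finset (Pd k)) : Set (Pd k)) := by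
    rw [Finset.coe_inter]; exact (isUpperSet_sect hB _).inter hV
  have H1 := harris_pair_nonneg (isUpperSet_sect hB (fun _ => 1)) hC0V
  have H2 := harris_pair_nonneg (isUpperSet_sect hB (fun _ => 2)) hC0V
  have H3 := harris_pair_nonneg (isUpperSet_sect hC (fun _ => 1)) hB0V
  have H4 := harris_pair_nonneg (isUpperSet_sect hC (fun _ => 2)) hB0V
  simp only [ind_sect, ind_inter_eq_mul] at K1 K2 K3 K4 H1 H2 H3 H4
  have P1 : 0 ≤ ∑ q : Pd k, ∑ r : Pd k, (if TotDist q r = true then (1:ℤ) else 0) *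
      ((ind B (glue (fun _ => 2) q) - ind B (glue (fun _ => 1) q)) * (ind C (glue (fun _ => 2) q) - ind C (glue (fun _ => 1) q))) :=
    Finset.sum_nonneg fun q _ => Finset.sum_nonneg fun r _ => mul_nonneg (by split_ifs <;> norm_num) (mul_nonneg (hB12 q) (hC12 q))
  have P2 : 0 ≤ ∑ q : Pd k, ∑ r : Pd k, (if TotDist q r = true then (1:ℤ) else 0) *
      (ind V q * ((ind B (glue (fun _ => 1) q) - ind B (glue (fun _ => 0) q)) * (ind C (glue (fun _ => 1) q) - ind C (glue (fun _ => 0) q)))) :=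
    Finset.sum_nonneg fun q _ => Finset.sum_nonneg fun r _ => mul_nonneg (by split_ifs <;> norm_num) (mul_nonneg (hVn q) (mul_nonneg (hB01 q) (hC01 q)))
  have P3 : 0 ≤ ∑ q : Pd k, ∑ r : Pd k, (if TotDist q r = true then (1:ℤ) else 0) *
      (ind V q * ((ind B (glue (fun _ => 2) q) - ind B (glue (fun _ => 0) q)) * (ind C (glue (fun _ => 2) q) - ind C (glue (fun _ => 0) q)))) :=
    Finset.sum_nonneg fun q _ => Finset.sum_nonneg fun r _ => mul_nonneg (by split_ifs <;> norm_num) (mul_nonneg (hVn q) (mul_nonneg (hB02 q) (hC02 q)))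
  have P4 : 0 ≤ ∑ q : Pd k, ∑ r : Pd k, (if TotDist q r = true then (1:ℤ) else 0) *
      ((1 - ind V q) * ((ind B (glue (fun _ => 2) r) - ind B (glue (fun _ => 1) r)) * (ind C (glue (fun _ => 2) (thirdPt q r)) - ind C (glue (fun _ => 1) (thirdPt q r))))) :=
    Finset.sum_nonneg fun q _ => Finset.sum_nonneg fun r _ => mul_nonneg (by split_ifs <;> norm_num)
      (mul_nonneg (hcV q) (mul_nonneg (hB12 r) (hC12 (thirdPt q r))))
  -- the identity, valid after Latin-role symmetrisation: (pd1 kernel) − (λ_A − d' kernel) = the thirteen columns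
  obtain ⟨c1, c2, c3, c4⟩ := And.intro (fun q r => (thirdPt_cancel (k := k) q r).1) (And.intro (fun q r => (thirdPt_cancel (k := k) q r).2.1)
    (And.intro (fun q r => (thirdPt_cancel (k := k) q r).2.2.1) (fun q r => (thirdPt_cancel (k := k) q r).2.2.2)))
  rw [← sub_nonneg]
  have Id := pairSum_eq_of_sym6_eq
    (fun q r => ( (2 * ind V q * ind B (glue (fun _ => 0) q) * ind C (glue (fun _ => 0) q) - ind V q * ind B (glue (fun _ => 1) r) * ind C (glue (fun _ => 1) r) - ind B (glue (fun _ => 0) q) * 1 * ind C (glue (fun _ => 1) r) - ind C (glue (fun _ => 0) q) * 1 * ind B (glue (fun _ => 1) r) + ind B (glue (fun _ => 0) q) * ind C (glue (fun _ => 1) r) * 1)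
        + (2 * ind V q * ind B (glue (fun _ => 0) q) * ind C (glue (fun _ => 0) q) - ind V q * ind B (glue (fun _ => 2) r) * ind C (glue (fun _ => 2) r) - ind B (glue (fun _ => 0) q) * 1 * ind C (glue (fun _ => 2) r) - ind C (glue (fun _ => 0) q) * 1 * ind B (glue (fun _ => 2) r) + ind B (glue (fun _ => 0) q) * ind C (glue (fun _ => 2) r) * 1)
        + (2 * 1 * ind B (glue (fun _ => 1) q) * ind C (glue (fun _ => 1) q) - 1 * ind B (glue (fun _ => 0) r) * ind C (glue (fun _ => 0) r) - ind B (glue (fun _ => 1) q) * ind V r * ind C (glue (fun _ => 0) r) - ind C (glue (fun _ => 1) q) * ind V r * ind B (glue (fun _ => 0) r) + ind B (glue (fun _ => 1) q) * ind C (glue (fun _ => 0) r) * 1)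
        + (2 * 1 * ind B (glue (fun _ => 1) q) * ind C (glue (fun _ => 1) q) - 1 * ind B (glue (fun _ => 2) r) * ind C (glue (fun _ => 2) r) - ind B (glue (fun _ => 1) q) * 1 * ind C (glue (fun _ => 2) r) - ind C (glue (fun _ => 1) q) * 1 * ind B (glue (fun _ => 2) r) + ind B (glue (fun _ => 1) q) * ind C (glue (fun _ => 2) r) * ind V (thirdPt q r))
        + (2 * 1 * ind B (glue (fun _ => 2) q) * ind C (glue (fun _ => 2) q) - 1 * ind B (glue (fun _ => 0) r) * ind C (glue (fun _ => 0) r) - ind B (glue (fun _ => 2) q) * ind V r * ind C (glue (fun _ => 0) r) - ind C (glue (fun _ => 2) q) * ind V r * ind B (glue (fun _ => 0) r) + ind B (glue (fun _ => 2) q) * ind C (glue (fun _ => 0) r) * 1)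
        + (2 * 1 * ind B (glue (fun _ => 2) q) * ind C (glue (fun _ => 2) q) - 1 * ind B (glue (fun _ => 1) r) * ind C (glue (fun _ => 1) r) - ind B (glue (fun _ => 2) q) * 1 * ind C (glue (fun _ => 1) r) - ind C (glue (fun _ => 2) q) * 1 * ind B (glue (fun _ => 1) r) + ind B (glue (fun _ => 2) q) * ind C (glue (fun _ => 1) r) * ind V (thirdPt q r)) )
        - (1 - ind V q) * (- 2 * (ind B (glue (fun _ => 0) q) * ind C (glue (fun _ => 0) q))
            + ind B (glue (fun _ => 1) q) * ind C (glue (fun _ => 1) q) + ind B (glue (fun _ => 2) q) * ind C (glue (fun _ => 2) q)))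
    (fun q r => (1:ℤ) * (ind B (glue (fun _ => 1) r) * (ind C (glue (fun _ => 2) r) - ind C (glue (fun _ => 2) (thirdPt q r))))
      + 1 * (ind B (glue (fun _ => 2) r) * (ind C (glue (fun _ => 1) r) - ind C (glue (fun _ => 1) (thirdPt q r))))
      + (1 - ind V q) * (ind B (glue (fun _ => 2) r) * (ind C (glue (fun _ => 2) r) - ind C (glue (fun _ => 2) (thirdPt q r))))
      + (1 - ind V q) * (ind B (glue (fun _ => 1) r) * (ind C (glue (fun _ => 1) r) - ind C (glue (fun _ => 1) (thirdPt q r))))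
      + ind B (glue (fun _ => 1) q) * (ind C (glue (fun _ => 0) q) * ind V q - ind C (glue (fun _ => 0) r) * ind V r)
      + ind B (glue (fun _ => 2) q) * (ind C (glue (fun _ => 0) q) * ind V q - ind C (glue (fun _ => 0) r) * ind V r)
      + ind C (glue (fun _ => 1) q) * (ind B (glue (fun _ => 0) q) * ind V q - ind B (glue (fun _ => 0) r) * ind V r)
      + ind C (glue (fun _ => 2) q) * (ind B (glue (fun _ => 0) q) * ind V q - ind B (glue (fun _ => 0) r) * ind V r)
      + (ind B (glue (fun _ => 2) q) - ind B (glue (fun _ => 1) q)) * (ind C (glue (fun _ => 2) q) - ind C (glue (fun _ => 1) q))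
      + ind V q * ((ind B (glue (fun _ => 1) q) - ind B (glue (fun _ => 0) q)) * (ind C (glue (fun _ => 1) q) - ind C (glue (fun _ => 0) q)))
      + ind V q * ((ind B (glue (fun _ => 2) q) - ind B (glue (fun _ => 0) q)) * (ind C (glue (fun _ => 2) q) - ind C (glue (fun _ => 0) q)))
      + (1 - ind V q) * ((ind B (glue (fun _ => 2) r) - ind B (glue (fun _ => 1) r)) * (ind C (glue (fun _ => 2) (thirdPt q r)) - ind C (glue (fun _ => 1) (thirdPt q r)))))
    (fun q r => by simp only [c1, c2, c3, c4, thirdPt_comm r q]; ring)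
  have e : (∑ q : Pd k, ∑ r : Pd k, (if TotDist q r = true then (1:ℤ) else 0) *
      ( (2 * ind V q * ind B (glue (fun _ => 0) q) * ind C (glue (fun _ => 0) q) - ind V q * ind B (glue (fun _ => 1) r) * ind C (glue (fun _ => 1) r) - ind B (glue (fun _ => 0) q) * 1 * ind C (glue (fun _ => 1) r) - ind C (glue (fun _ => 0) q) * 1 * ind B (glue (fun _ => 1) r) + ind B (glue (fun _ => 0) q) * ind C (glue (fun _ => 1) r) * 1)
        + (2 * ind V q * ind B (glue (fun _ => 0) q) * ind C (glue (fun _ => 0) q) - ind V q * ind B (glue (fun _ => 2) r) * ind C (glue (fun _ => 2) r) - ind B (glue (fun _ => 0) q) * 1 * ind C (glue (fun _ => 2) r) - ind C (glue (fun _ => 0) q) * 1 * ind B (glue (fun _ => 2) r) + ind B (glue (fun _ => 0) q) * ind C (glue (fun _ => 2) r) * 1)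
        + (2 * 1 * ind B (glue (fun _ => 1) q) * ind C (glue (fun _ => 1) q) - 1 * ind B (glue (fun _ => 0) r) * ind C (glue (fun _ => 0) r) - ind B (glue (fun _ => 1) q) * ind V r * ind C (glue (fun _ => 0) r) - ind C (glue (fun _ => 1) q) * ind V r * ind B (glue (fun _ => 0) r) + ind B (glue (fun _ => 1) q) * ind C (glue (fun _ => 0) r) * 1)
        + (2 * 1 * ind B (glue (fun _ => 1) q) * ind C (glue (fun _ => 1) q) - 1 * ind B (glue (fun _ => 2) r) * ind C (glue (fun _ => 2) r) - ind B (glue (fun _ => 1) q) * 1 * ind C (glue (fun _ => 2) r) - ind C (glue (fun _ => 1) q) * 1 * ind B (glue (fun _ => 2) r) + ind B (glue (fun _ => 1) q) * ind C (glue (fun _ => 2) r) * ind V (thirdPt q r))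
        + (2 * 1 * ind B (glue (fun _ => 2) q) * ind C (glue (fun _ => 2) q) - 1 * ind B (glue (fun _ => 0) r) * ind C (glue (fun _ => 0) r) - ind B (glue (fun _ => 2) q) * ind V r * ind C (glue (fun _ => 0) r) - ind C (glue (fun _ => 2) q) * ind V r * ind B (glue (fun _ => 0) r) + ind B (glue (fun _ => 2) q) * ind C (glue (fun _ => 0) r) * 1)
        + (2 * 1 * ind B (glue (fun _ => 2) q) * ind C (glue (fun _ => 2) q) - 1 * ind B (glue (fun _ => 1) r) * ind C (glue (fun _ => 1) r) - ind B (glue (fun _ => 2) q) * 1 * ind C (glue (fun _ => 1) r) - ind C (glue (fun _ => 2) q) * 1 * ind B (glue (fun _ => 1) r) + ind B (glue (fun _ => 2) q) * ind C (glue (fun _ => 1) r) * ind V (thirdPt q r)) ))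
    - (∑ q : Pd k, ∑ r : Pd k, (if TotDist q r = true then (1:ℤ) else 0) *
          ((1 - ind V q) * (- 2 * (ind B (glue (fun _ => 0) q) * ind C (glue (fun _ => 0) q))
            + ind B (glue (fun _ => 1) q) * ind C (glue (fun _ => 1) q) + ind B (glue (fun _ => 2) q) * ind C (glue (fun _ => 2) q))))
    = (∑ q : Pd k, ∑ r : Pd k, (if TotDist q r = true then (1:ℤ) else 0) * ((1:ℤ) * (ind B (glue (fun _ => 1) r) * (ind C (glue (fun _ => 2) r) - ind C (glue (fun _ => 2) (thirdPt q r))))))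
      + (∑ q : Pd k, ∑ r : Pd k, (if TotDist q r = true then (1:ℤ) else 0) * (1 * (ind B (glue (fun _ => 2) r) * (ind C (glue (fun _ => 1) r) - ind C (glue (fun _ => 1) (thirdPt q r))))))
      + (∑ q : Pd k, ∑ r : Pd k, (if TotDist q r = true then (1:ℤ) else 0) * ((1 - ind V q) * (ind B (glue (fun _ => 2) r) * (ind C (glue (fun _ => 2) r) - ind C (glue (fun _ => 2) (thirdPt q r))))))
      + (∑ q : Pd k, ∑ r : Pd k, (if TotDist q r = true then (1:ℤ) else 0) * ((1 - ind V q) * (ind B (glue (fun _ => 1) r) * (ind C (glue (fun _ => 1) r) - ind C (glue (fun _ => 1) (thirdPt q r))))))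
      + (∑ q : Pd k, ∑ r : Pd k, (if TotDist q r = true then (1:ℤ) else 0) * (ind B (glue (fun _ => 1) q) * (ind C (glue (fun _ => 0) q) * ind V q - ind C (glue (fun _ => 0) r) * ind V r)))
      + (∑ q : Pd k, ∑ r : Pd k, (if TotDist q r = true then (1:ℤ) else 0) * (ind B (glue (fun _ => 2) q) * (ind C (glue (fun _ => 0) q) * ind V q - ind C (glue (fun _ => 0) r) * ind V r)))
      + (∑ q : Pd k, ∑ r : Pd k, (if TotDist q r = true then (1:ℤ) else 0) * (ind C (glue (fun _ => 1) q) * (ind B (glue (fun _ => 0) q) * ind V q - ind B (glue (fun _ => 0) r) * ind V r)))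
      + (∑ q : Pd k, ∑ r : Pd k, (if TotDist q r = true then (1:ℤ) else 0) * (ind C (glue (fun _ => 2) q) * (ind B (glue (fun _ => 0) q) * ind V q - ind B (glue (fun _ => 0) r) * ind V r)))
      + (∑ q : Pd k, ∑ r : Pd k, (if TotDist q r = true then (1:ℤ) else 0) * ((ind B (glue (fun _ => 2) q) - ind B (glue (fun _ => 1) q)) * (ind C (glue (fun _ => 2) q) - ind C (glue (fun _ => 1) q))))
      + (∑ q : Pd k, ∑ r : Pd k, (if TotDist q r = true then (1:ℤ) else 0) * (ind V q * ((ind B (glue (fun _ => 1) q) - ind B (glue (fun _ => 0) q)) * (ind C (glue (fun _ => 1) q) - ind C (glue (fun _ => 0) q)))))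
      + (∑ q : Pd k, ∑ r : Pd k, (if TotDist q r = true then (1:ℤ) else 0) * (ind V q * ((ind B (glue (fun _ => 2) q) - ind B (glue (fun _ => 0) q)) * (ind C (glue (fun _ => 2) q) - ind C (glue (fun _ => 0) q)))))
      + (∑ q : Pd k, ∑ r : Pd k, (if TotDist q r = true then (1:ℤ) else 0) * ((1 - ind V q) * ((ind B (glue (fun _ => 2) r) - ind B (glue (fun _ => 1) r)) * (ind C (glue (fun _ => 2) (thirdPt q r)) - ind C (glue (fun _ => 1) (thirdPt q r)))))) := by
    rw [← Finset.sum_sub_distrib]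
    simp only [← Finset.sum_sub_distrib, ← mul_sub]
    rw [Id]
    simp only [mul_add, Finset.sum_add_distrib]
  linarith [e, K1, K2, K3, K4, H1, H2, H3, H4, P1, P2, P3, P4]

/-- **`{x₀ ≥ 1} ∨ V` IS DIAGONALLY CERTIFIED FOR EVERY UP-SET `V`, hence good in every dimension**: `0 ≤ sStarD (A × [3]^n) B C` for all `n` and all up-sets
`B, C` (the certificate-level form of the atom-free literal-union step). [this work] -/
theorem sStarD_cylSet_literalOneOr_nonneg (hV : IsUpperSet (V : Set (Pd k))) (hA : ∀ ξ z, glue ξ z ∈ A ↔ (1 ≤ ξ 0 ∨ z ∈ V))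
    {n : ℕ} {B C : Finset (Pd (n + (1 + k)))} (hB : IsUpperSet (B : Set (Pd (n + (1 + k))))) (hC : IsUpperSet (C : Set (Pd (n + (1 + k))))) :
    0 ≤ sStarD (cylSet A : Finset (Pd (n + (1 + k)))) B C :=
  sStarD_cylSet_nonneg_of_diagCert A
    (fun x => if freeOf x 0 = 0 then 2 * 2 ^ k * ind V (cellOf x) else 2 * 2 ^ k + (2 ^ k * ind V (cellOf x) - (nuCount V (cellOf x) : ℤ)))
    (fun x => by
      show 0 ≤ (if freeOf x 0 = 0 then 2 * 2 ^ k * ind V (cellOf x) else 2 * 2 ^ k + (2 ^ k * ind V (cellOf x) - (nuCount V (cellOf x) : ℤ)))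
      have h1 := ind_nonneg' V (cellOf x)
      have h2 := nuCount_le_two_pow V (cellOf x)
      have h3 : (0:ℤ) ≤ 2 ^ k := by positivity
      split_ifs
      · exact mul_nonneg (by positivity) h1
      · nlinarith)
    (fun W' hW' => diagCert_literalOneOr_T hA W' hW')
    (fun P Q hP hQ => diagCert_literalOneOr_N hV hA P Q hP hQ) hB hC

end Summit.CriticalPhenomena.PercolationContinuityZ3.Theorems.SahiGridPattern
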